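/-
Copyright (c) 2026 the pub-hodgecm-mathlib formalisation cell (harness21).  Prover seat hodgecm-mathlib-K2Liu-p23 (g2), Track B «K2-LIT»,
#184♮ = hLiu418 = `stmt-HodgeConjecture-24832`; #42F′ FACE-G organ F4 (G-gen), road (E) (RULINGS M-158r/s/u), brick (E-a2) «THE FIRST FUNDAMENTAL
THEOREM FOR `GL_p` ON A SQUARE VECTOR BLOCK: a `GL_p`-invariant polynomial in `p` vectors and any number of covectors is a polynomial in the
contractions» (F4 lead K2Liu-p27 (g2) 2026-09-04T23:03:11Z; LEAD F0P6-plan (g14) BATCH #117–#119).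
KERNEL: theorems only.
-/
import Mathlib.Algebra.MvPolynomial.Funext
import Mathlib.LinearAlgebra.Matrix.MvPolynomial
import Mathlib.LinearAlgebra.Matrix.NonsingularInverse
import Mathlib.LinearAlgebra.Matrix.GeneralLinearGroup.Defs
import Mathlib.RingTheory.Adjoin.Basic
import HarnessLib

/-!
# Crux `HLiu418`, FACE-G organ F4, road (E), brick (E-a2): THE FIRST FUNDAMENTAL THEOREM OF INVARIANT THEORY FOR `GL_p`,
# SQUARE CASE — a `GL_p`-invariant polynomial in `p` vectors `x_1, …, x_p ∈ K^p` and covectors `y_j` is a polynomial in the contractions `⟨x_i, y_j⟩`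

Cell `hodgecm-mathlib`, crux item hLiu418 = `stmt-HodgeConjecture-24832`, route of record `HCCMUnconditional`; squad K2 ∕ K2Liu, road `K2_Liu`,
socket #42F′, FACE-G organ F4 (G-gen) under RULING M-158r «(E) COMPACT SEE-SAW + FFT + PBW INDUCTION + `K_H`-AVERAGING» (K2E5-r02 (g6)); F4 lead
K2Liu-p27 (g2), desks K2Liu-p10 (g6) ∕ K2E5-r02 (g6).  THEOREMS ONLY (no `def`, no `instance`, no `notation`, no named-fact hypothesis, no `sorry`);
lane `--supports stmt-HodgeConjecture-24832 --as helper` (count-neutral helper).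

WHY.  STEP 1 of road (E) needs, for `p ≤ 2`, the first fundamental theorem for `GL_p` [cite: Weyl1939, Thm. 2.6.A]
[cite: GoodmanWallachGTM255, Thm. 5.2.1]: a polynomial `f(x, y)` in the entries of `x ∈ M_{2×p}` (rows = vectors `x_i ∈ K^p`, `x ↦ x·g`) and
`y ∈ M_{2×p}` (rows = covectors, `y ↦ y·(g⁻¹)ᵀ`) invariant under every `g ∈ GL_p(K)` is a polynomial in the contractions
`z_{ij} = Σ_a x_{ia} y_{ja}`.  For `p = 2` the vector block `x` is SQUARE, and the theorem has the classical slick proof by the substitution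
`g := x⁻¹` on the Zariski-open set `{det x ≠ 0}` — this file.  (The `U(p) → GL_p(ℂ)` transfer is brick (E-a1); `p = 1` is the sibling brick
`K2LiuUnitaryFFTContractionsOne`; general `p` is (E-a3) via ★ `K2LiuTensorPowerDoubleCommutant`.)

THE STATEMENT AS TYPED.  Generic square currency: the vector block is indexed by `m × m` (row `i`, column `a`; `GL m K` acts on the column), the
covector block by `ι × m`; the ring is `R = MvPolynomial ((m × m) ⊕ (ι × m)) K` over a FIELD `K`; the action is ANY family of `K`-algebra
endomorphisms `Φ g : R →ₐ[K] R` with the substitution values of (E-a0) `K2LiuUnitaryPolySubstDefs.polySubst` —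
`Φ g (X (inl (i,a))) = Σ_b X (inl (i,b)) * C (g_{ba})` and `Φ g (X (inr (j,a))) = Σ_b X (inr (j,b)) * C ((g⁻¹)_{ab})` — so the consumer plugs
`Φ := polySubst`, `polySubst_X_inl`, `polySubst_X_inr` (at `m = ι = Fin 2`, i.e. `p = 2`) and `hf := (IsGLInvariant f)` verbatim.

* **`aeval_comp_eq_aeval_point`** — evaluating `Φ g q` at a point `P = (x₀, y₀)` is evaluating `q` at the moved point `(x₀·g, y₀·(g⁻¹)ᵀ)`.
* **`aeval_eq_aeval_normalForm_of_det_ne_zero`** — at a point with `det x₀ ≠ 0`, an invariant `f` satisfies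
  `f(x₀, y₀) = f(1, y₀·x₀ᵀ) = (NF f)(x₀, y₀)`, where the NORMAL FORM `NF f := aeval τ f` substitutes `x_{ia} ↦ δ_{ia}` and
  `y_{ja} ↦ z_{aj} = Σ_b x_{ab} y_{jb}` (take `g := x₀⁻¹`).
* **`det_xBlock_ne_zero`** — the generic determinant `det (X (inl (i,a)))_{i,a}` is a non-zero polynomial (Mathlib `det_mvPolynomialX_ne_zero`
  transported along `rename inl`).
* **`eq_aeval_normalForm_of_glInvariant`** (`K` infinite) — `f = NF f`: the polynomial `det x · (f − NF f)` vanishes at every point, hence is `0`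
  (`MvPolynomial.funext`), and `det x ≠ 0` in the integral domain `R`.
* **`mem_subalgebra_of_glInvariant`**, **`mem_adjoin_contractions_of_glInvariant`** — hence `f` lies in every subalgebra containing the contractions,
  in particular in `Algebra.adjoin K {z_{ij}}`; **`mem_adjoin_contractions_of_aeval_subst_eq`** — the same with the explicit substitution `aeval σ_g`.

No bidegree hypothesis is needed in the square case (balance is automatic: `NF f` is a polynomial in the `z_{aj}`).  Degenerate instances: `m = ∅`
(`R = K[y_∅] = K`, `det = 1`, `f` constant ✓); `ι = ∅` (invariants of `p` vectors alone are constants: `NF f = f(1)` ✓) — covered as written.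
References: [Weyl1939] Ch. II §6, Thm. 2.6.A; [GoodmanWallachGTM255] §5.2.1, Thm. 5.2.1; [FultonHarrisGTM129] App. F.1.
HONEST LABEL.  Count-neutral helper; it retires nothing by itself: `HC_CM` is proved only modulo the 7 printed citations (2 remaining named inputs:
hLiu418 = `stmt-HodgeConjecture-24832`, h413 = `stmt-HodgeConjecture-24833`) until rung 0 closes.

## References
* [Weyl1939] H. Weyl, *The Classical Groups. Their Invariants and Representations*, Princeton (1939), Ch. II §6, Thm. 2.6.A.
* [GoodmanWallachGTM255] R. Goodman, N. R. Wallach, *Symmetry, Representations, and Invariants*, GTM 255 (2009), §5.2.1, Thm. 5.2.1.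
* [FultonHarrisGTM129] W. Fulton, J. Harris, *Representation Theory. A First Course*, GTM 129, Springer (1991), App. F.1.
-/

set_option autoImplicit false
set_option linter.dupNamespace false -- the mandated namespace repeats `HodgeConjecture.HodgeConjecture`

open scoped BigOperators
open MvPolynomial Matrix

namespace Summit.HodgeConjecture.HodgeConjecture.Cruxes.HLiu418.K2LiuUnitaryFFTContractionsTwo

variable {K : Type*} [Field K] {m : Type*} [Fintype m] [DecidableEq m] {ι : Type*}

omit [Fintype m] [DecidableEq m] in
/-- **evaluation after the substitution `Φ g` is evaluation at the moved point**: for any `K`-algebra endomorphism `Φ g` of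
`K[x_{ia}, y_{ja}]` and any point `P`, `(Φ g q)(P) = q(P′)` with `P′ v := (Φ g (X v))(P)`. [folklore] -/
theorem aeval_comp_eq_aeval_point
    (Ψ : MvPolynomial ((m × m) ⊕ (ι × m)) K →ₐ[K] MvPolynomial ((m × m) ⊕ (ι × m)) K)
    (P : (m × m) ⊕ (ι × m) → K) (q : MvPolynomial ((m × m) ⊕ (ι × m)) K) :
    aeval P (Ψ q) = aeval (fun v => aeval P (Ψ (X v))) q := by
  have h : (aeval P).comp Ψ = aeval (fun v => aeval P (Ψ (X v))) :=
    MvPolynomial.algHom_ext fun v => by simp only [AlgHom.comp_apply, aeval_X]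
  exact congrArg (fun F : MvPolynomial ((m × m) ⊕ (ι × m)) K →ₐ[K] K => F q) h

/-- **the normal form at an invertible point** (the `g := x⁻¹` trick): if `f` is invariant under the substitutions `x ↦ x·g`, `y ↦ y·(g⁻¹)ᵀ`
(`g ∈ GL_m(K)`), then at every point `P = (x₀, y₀)` with `det x₀ ≠ 0`,
`f(x₀, y₀) = f(1, y₀·x₀ᵀ) = (aeval τ f)(x₀, y₀)` where `τ (x_{ia}) = δ_{ia}` and `τ (y_{ja}) = Σ_b x_{ab} y_{jb}`.
[cite: Weyl1939, Thm. 2.6.A] [cite: GoodmanWallachGTM255, Thm. 5.2.1] -/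
theorem aeval_eq_aeval_normalForm_of_det_ne_zero
    (Φ : GL m K → MvPolynomial ((m × m) ⊕ (ι × m)) K →ₐ[K] MvPolynomial ((m × m) ⊕ (ι × m)) K)
    (hΦl : ∀ (g : GL m K) (i a : m),
      Φ g (X (Sum.inl (i, a))) = ∑ b, X (Sum.inl (i, b)) * C ((g : Matrix m m K) b a))
    (hΦr : ∀ (g : GL m K) (j : ι) (a : m),
      Φ g (X (Sum.inr (j, a))) = ∑ b, X (Sum.inr (j, b)) * C (((g⁻¹ : GL m K) : Matrix m m K) a b))
    (f : MvPolynomial ((m × m) ⊕ (ι × m)) K) (hf : ∀ g : GL m K, Φ g f = f)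
    (P : (m × m) ⊕ (ι × m) → K) (hP : (Matrix.of fun i a : m => P (Sum.inl (i, a))).det ≠ 0) :
    aeval P f = aeval P (aeval (Sum.elim (fun ia : m × m => if ia.1 = ia.2 then (1 : MvPolynomial ((m × m) ⊕ (ι × m)) K) else 0)
      (fun ja : ι × m => ∑ b, X (Sum.inl (ja.2, b)) * X (Sum.inr (ja.1, b)))) f) := by
  set x₀ : Matrix m m K := Matrix.of fun i a : m => P (Sum.inl (i, a)) with hx₀
  set g : GL m K := Matrix.GeneralLinearGroup.mkOfDetNeZero x₀ hP with hg
  have hgv : (g : Matrix m m K) = x₀ := by simp only [hg, Matrix.GeneralLinearGroup.val_mkOfDetNeZero]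
  -- the moved point `(x₀·x₀⁻¹, y₀·x₀ᵀ)` IS the point at which the normal form evaluates
  have hpt : (fun v => aeval P (Φ g⁻¹ (X v))) = fun v => aeval P
      (Sum.elim (fun ia : m × m => if ia.1 = ia.2 then (1 : MvPolynomial ((m × m) ⊕ (ι × m)) K) else 0)
        (fun ja : ι × m => ∑ b, X (Sum.inl (ja.2, b)) * X (Sum.inr (ja.1, b))) v) := by
    funext v
    rcases v with ⟨i, a⟩ | ⟨j, a⟩
    · -- `x`-coordinate: `Σ_b x₀_{ib} (x₀⁻¹)_{ba} = δ_{ia}`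
      rw [hΦl]
      have h1 : ∑ b, P (Sum.inl (i, b)) * ((g⁻¹ : GL m K) : Matrix m m K) b a = if i = a then 1 else 0 := by
        have hmul : (g : Matrix m m K) * ((g⁻¹ : GL m K) : Matrix m m K) = 1 := by
          rw [← Units.val_mul, mul_inv_cancel, Units.val_one]
        have := congrFun (congrFun hmul i) a
        rw [Matrix.mul_apply, Matrix.one_apply, hgv] at this
        simpa only [hx₀, Matrix.of_apply] using this
      simp only [map_sum, map_mul, aeval_X, aeval_C, Algebra.algebraMap_self_apply, Sum.elim_inl, h1]
      split_ifs
      · exact (map_one (aeval P)).symm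
      · exact (map_zero (aeval P)).symm
    · -- `y`-coordinate: `Σ_b y₀_{jb} x₀_{ab} = z_{aj}(x₀, y₀)`
      rw [hΦr, inv_inv]
      simp only [map_sum, map_mul, aeval_X, aeval_C, Algebra.algebraMap_self_apply, Sum.elim_inr, hgv, hx₀, Matrix.of_apply]
      exact Finset.sum_congr rfl fun b _ => mul_comm _ _
  conv_lhs => rw [← hf g⁻¹]
  rw [aeval_comp_eq_aeval_point (Φ g⁻¹) P f, ← AlgHom.comp_apply (aeval P), MvPolynomial.comp_aeval, hpt]

/-- **the generic determinant of the vector block is a non-zero polynomial**: `det (x_{ia})_{i,a} ≠ 0` in `K[x_{ia}, y_{ja}]`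
(Mathlib's `det_mvPolynomialX_ne_zero`, transported along `rename inl`). [folklore] -/
theorem det_xBlock_ne_zero :
    (Matrix.of fun i a : m => (X (Sum.inl (i, a)) : MvPolynomial ((m × m) ⊕ (ι × m)) K)).det ≠ 0 := by
  have h1 : (Matrix.of fun i a : m => (X (Sum.inl (i, a)) : MvPolynomial ((m × m) ⊕ (ι × m)) K)).det =
      MvPolynomial.rename (Sum.inl : m × m → (m × m) ⊕ (ι × m)) (Matrix.mvPolynomialX m m K).det := by
    rw [AlgHom.map_det]
    congr 1
    ext i a
    simp only [Matrix.of_apply, AlgHom.mapMatrix_apply, Matrix.map_apply, Matrix.mvPolynomialX_apply, rename_X]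
  rw [h1]
  exact (map_ne_zero_iff _ (rename_injective _ Sum.inl_injective)).mpr (Matrix.det_mvPolynomialX_ne_zero m K)

/-- **THE FIRST FUNDAMENTAL THEOREM, SQUARE CASE, NORMAL FORM** (`K` an infinite field): a polynomial `f ∈ K[x_{ia}, y_{ja}]` (`i, a ∈ m`,
`j ∈ ι`) invariant under all substitutions `x ↦ x·g`, `y ↦ y·(g⁻¹)ᵀ`, `g ∈ GL_m(K)`, EQUALS its normal form:
`f = aeval τ f` with `τ (x_{ia}) = δ_{ia}`, `τ (y_{ja}) = Σ_b x_{ab} y_{jb}` — i.e. `f(x, y) = f(1, y·xᵀ)` identically.  PROOF: both sides agree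
at every point with `det x ≠ 0` (`aeval_eq_aeval_normalForm_of_det_ne_zero`), so `det x · (f − aeval τ f)` vanishes everywhere, hence is the
zero polynomial (`K` infinite), and `det x ≠ 0` in the integral domain `K[x, y]`. [cite: Weyl1939, Thm. 2.6.A]
[cite: GoodmanWallachGTM255, Thm. 5.2.1] -/
theorem eq_aeval_normalForm_of_glInvariant [Infinite K]
    (Φ : GL m K → MvPolynomial ((m × m) ⊕ (ι × m)) K →ₐ[K] MvPolynomial ((m × m) ⊕ (ι × m)) K)
    (hΦl : ∀ (g : GL m K) (i a : m),
      Φ g (X (Sum.inl (i, a))) = ∑ b, X (Sum.inl (i, b)) * C ((g : Matrix m m K) b a))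
    (hΦr : ∀ (g : GL m K) (j : ι) (a : m),
      Φ g (X (Sum.inr (j, a))) = ∑ b, X (Sum.inr (j, b)) * C (((g⁻¹ : GL m K) : Matrix m m K) a b))
    (f : MvPolynomial ((m × m) ⊕ (ι × m)) K) (hf : ∀ g : GL m K, Φ g f = f) :
    f = aeval (Sum.elim (fun ia : m × m => if ia.1 = ia.2 then (1 : MvPolynomial ((m × m) ⊕ (ι × m)) K) else 0)
      (fun ja : ι × m => ∑ b, X (Sum.inl (ja.2, b)) * X (Sum.inr (ja.1, b)))) f := by
  set F := aeval (Sum.elim (fun ia : m × m => if ia.1 = ia.2 then (1 : MvPolynomial ((m × m) ⊕ (ι × m)) K) else 0)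
      (fun ja : ι × m => ∑ b, X (Sum.inl (ja.2, b)) * X (Sum.inr (ja.1, b)))) f with hF
  set D : MvPolynomial ((m × m) ⊕ (ι × m)) K := (Matrix.of fun i a : m => (X (Sum.inl (i, a)) : MvPolynomial ((m × m) ⊕ (ι × m)) K)).det
    with hD
  have hD0 : D ≠ 0 := det_xBlock_ne_zero
  have hDF : D * f = D * F := by
    apply MvPolynomial.funext
    intro P
    rw [map_mul, map_mul]
    by_cases hP : (Matrix.of fun i a : m => P (Sum.inl (i, a))).det = 0
    · have hPD : eval P D = 0 := by
        rw [hD, RingHom.map_det, ← hP]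
        congr 1
        ext i a
        simp only [RingHom.mapMatrix_apply, Matrix.map_apply, Matrix.of_apply, eval_X]
      rw [hPD, zero_mul, zero_mul]
    · have key := aeval_eq_aeval_normalForm_of_det_ne_zero Φ hΦl hΦr f hf P hP
      rw [← hF] at key
      rw [← MvPolynomial.aeval_eq_eval]
      exact congrArg (fun t => aeval P D * t) key
  exact mul_left_cancel₀ hD0 hDF

/-- **THE FIRST FUNDAMENTAL THEOREM, SQUARE CASE, SUBALGEBRA FORM** (`K` an infinite field): a `GL_m(K)`-invariant polynomial in the square vector
block `x = (x_{ia})` and the covector block `y = (y_{ja})` lies in every `K`-subalgebra containing the contractions `z_{ij} = Σ_b x_{ib} y_{jb}`.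
[cite: Weyl1939, Thm. 2.6.A] [cite: GoodmanWallachGTM255, Thm. 5.2.1] -/
theorem mem_subalgebra_of_glInvariant [Infinite K]
    (Φ : GL m K → MvPolynomial ((m × m) ⊕ (ι × m)) K →ₐ[K] MvPolynomial ((m × m) ⊕ (ι × m)) K)
    (hΦl : ∀ (g : GL m K) (i a : m),
      Φ g (X (Sum.inl (i, a))) = ∑ b, X (Sum.inl (i, b)) * C ((g : Matrix m m K) b a))
    (hΦr : ∀ (g : GL m K) (j : ι) (a : m),
      Φ g (X (Sum.inr (j, a))) = ∑ b, X (Sum.inr (j, b)) * C (((g⁻¹ : GL m K) : Matrix m m K) a b))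
    (f : MvPolynomial ((m × m) ⊕ (ι × m)) K) (hf : ∀ g : GL m K, Φ g f = f)
    (S : Subalgebra K (MvPolynomial ((m × m) ⊕ (ι × m)) K))
    (hS : ∀ (i : m) (j : ι), (∑ b, X (Sum.inl (i, b)) * X (Sum.inr (j, b)) : MvPolynomial ((m × m) ⊕ (ι × m)) K) ∈ S) :
    f ∈ S := by
  rw [eq_aeval_normalForm_of_glInvariant Φ hΦl hΦr f hf]
  have hle : (aeval (Sum.elim (fun ia : m × m => if ia.1 = ia.2 then (1 : MvPolynomial ((m × m) ⊕ (ι × m)) K) else 0)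
      (fun ja : ι × m => ∑ b, X (Sum.inl (ja.2, b)) * X (Sum.inr (ja.1, b))))).range ≤ S := by
    rw [← Algebra.adjoin_range_eq_range_aeval]
    refine Algebra.adjoin_le ?_
    rintro q ⟨v, rfl⟩
    rcases v with ⟨i, a⟩ | ⟨j, a⟩
    · simp only [Sum.elim_inl]
      split_ifs
      · exact S.one_mem
      · exact S.zero_mem
    · exact hS a j
  exact hle ⟨f, rfl⟩

/-- **THE FIRST FUNDAMENTAL THEOREM FOR `GL_p`, SQUARE CASE** (`K` an infinite field; at `m = ι = Fin 2` this is brick (E-a2) for `p = 2` in the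
currency of (E-a0) `K2LiuUnitaryPolySubstDefs`: plug `Φ := polySubst`, `polySubst_X_inl`, `polySubst_X_inr`, `hf := ‹IsGLInvariant f›`): a
polynomial invariant under `x ↦ x·g`, `y ↦ y·(g⁻¹)ᵀ` for all `g ∈ GL_m(K)` is a polynomial in the contractions `z_{ij} = Σ_b x_{ib} y_{jb}`.
[cite: Weyl1939, Thm. 2.6.A] [cite: GoodmanWallachGTM255, Thm. 5.2.1] -/
theorem mem_adjoin_contractions_of_glInvariant [Infinite K]
    (Φ : GL m K → MvPolynomial ((m × m) ⊕ (ι × m)) K →ₐ[K] MvPolynomial ((m × m) ⊕ (ι × m)) K)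
    (hΦl : ∀ (g : GL m K) (i a : m),
      Φ g (X (Sum.inl (i, a))) = ∑ b, X (Sum.inl (i, b)) * C ((g : Matrix m m K) b a))
    (hΦr : ∀ (g : GL m K) (j : ι) (a : m),
      Φ g (X (Sum.inr (j, a))) = ∑ b, X (Sum.inr (j, b)) * C (((g⁻¹ : GL m K) : Matrix m m K) a b))
    (f : MvPolynomial ((m × m) ⊕ (ι × m)) K) (hf : ∀ g : GL m K, Φ g f = f) :
    f ∈ Algebra.adjoin K (Set.range fun ij : m × ι =>
      (∑ b, X (Sum.inl (ij.1, b)) * X (Sum.inr (ij.2, b)) : MvPolynomial ((m × m) ⊕ (ι × m)) K)) :=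
  mem_subalgebra_of_glInvariant Φ hΦl hΦr f hf _ fun i j => Algebra.subset_adjoin ⟨(i, j), rfl⟩

/-- **THE FIRST FUNDAMENTAL THEOREM FOR `GL_p`, SQUARE CASE, EXPLICIT SUBSTITUTION** (`K` an infinite field): the same with the action spelled as
the explicit `aeval` of the substituted variables `σ_g (x_{ia}) = Σ_b x_{ib} g_{ba}`, `σ_g (y_{ja}) = Σ_b y_{jb} (g⁻¹)_{ab}`.
[cite: Weyl1939, Thm. 2.6.A] [cite: GoodmanWallachGTM255, Thm. 5.2.1] -/
theorem mem_adjoin_contractions_of_aeval_subst_eq [Infinite K]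
    (f : MvPolynomial ((m × m) ⊕ (ι × m)) K)
    (hf : ∀ g : GL m K, aeval (Sum.elim
        (fun ia : m × m => ∑ b, X (Sum.inl (ia.1, b)) * C ((g : Matrix m m K) b ia.2))
        (fun ja : ι × m => ∑ b, X (Sum.inr (ja.1, b)) * C (((g⁻¹ : GL m K) : Matrix m m K) ja.2 b)) :
          (m × m) ⊕ (ι × m) → MvPolynomial ((m × m) ⊕ (ι × m)) K) f = f) :
    f ∈ Algebra.adjoin K (Set.range fun ij : m × ι =>
      (∑ b, X (Sum.inl (ij.1, b)) * X (Sum.inr (ij.2, b)) : MvPolynomial ((m × m) ⊕ (ι × m)) K)) :=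
  mem_adjoin_contractions_of_glInvariant (fun g : GL m K => aeval (Sum.elim
        (fun ia : m × m => ∑ b, X (Sum.inl (ia.1, b)) * C ((g : Matrix m m K) b ia.2))
        (fun ja : ι × m => ∑ b, X (Sum.inr (ja.1, b)) * C (((g⁻¹ : GL m K) : Matrix m m K) ja.2 b)) :
          (m × m) ⊕ (ι × m) → MvPolynomial ((m × m) ⊕ (ι × m)) K))
    (fun g i a => by simp only [aeval_X, Sum.elim_inl]) (fun g j a => by simp only [aeval_X, Sum.elim_inr]) f hf

end Summit.HodgeConjecture.HodgeConjecture.Cruxes.HLiu418.K2LiuUnitaryFFTContractionsTwo
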